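import Summits.QuantumFields.BalabanUV.Beta.GAN24.DirichletExhaustionDeltaZSymm
import Summits.QuantumFields.BalabanUV.Beta.GAN24.DirichletExhaustionDeltaZConv

/-!
# `BalabanUV.Beta.GAN24.EffectiveLaplacianLimit` — binder row G-an2-4 ∕ (CONV-C): THE `k = ∞` LIMIT OF THE EFFECTIVE-FORM CONSTITUENT
# NAMED EXPLICITLY — Bałaban's PERFECT effective gauge-field Laplacian `Δ_∞` on the bonds of `ℤ^{d+1}` as the lattice kernel of the CONTINUUM
# (1.66) multiplier, with `Δ_k → Δ_∞` at King's rate `L^{−2k}` for EVERY blocking factor `L` (row owner lineage gan24-p3, gen 12)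

NOT IN PRINT as a theorem about Bałaban's objects; OUR PROOF (elementary analysis over tree theorems BY NAME).  HONEST FRAMING (cell contract,
verbatim): «discharging `BetaPertH` makes Bałaban's UV stability UNCONDITIONAL — a real constructive-QFT result; it is NOT the continuum limit and
NOT the Clay problem.»  HONEST DEPENDENCY (verbatim): «continuum YM on T⁴ ⇐ BetaPertH ∧ nine spine estimates (0/9 proved); BetaPertH ⇐ (D1) ∧ (D4) ∧
CAP+tail; G-an2-4 gates asym, D1 and NE2/3/4.»

WHY.  Row G-an2-4 ∕ (CONV-C) is the one-step η-rate comparison of the `U = 1` constituent kernels.  For the EFFECTIVE-FORM constituent `Δ_k`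
(gan24-p2's `DirichletExhaustionDeltaZ.deltaZ L k`, [Balaban1984PropagatorsI] (1.66) p. 29 typed on `ℤ^{d+1}`) the tree holds the CAUCHY form
(`deltaZ_step_abs_le`, `DirichletExhaustionDeltaZConv.decayCauchy_deltaZ`) but no NAME for the limit.  The t4-ne2 lineage already constructed the
continuum multiplier `T4Rate166StripDirect.W166lim` (King (4.31) on the complex strip, with rate `C166(d)/n²`).  This file carries that limit to
POSITION SPACE: the perfect Laplacian `Δ_∞ := deltaZLim` is the bond kernel built, exactly as `deltaZ`, from the real parts of the lattice kernels
of the limit entry symbols `GsymLim = ½·W166lim·(e^{−ip_a} − 1)(e^{ip_b} − 1)`.  It is `L`-FREE and `k`-FREE: every blocking factor `L ≥ 2` produces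
the SAME perfect object (`tendsto_deltaZ`).  Consumer (road FP of binder row D1, leaf N0b-K «explicit symbol of `KPerf`», multiplier quarter): with
`FP.ConvergenceJMMultiplier.mmJM_apply`∕`tendsto_mm_KTot_KPerf` the (inr,inr) block of the perfect resolvent is `(2/Lc^{8m})·Δ_∞` at the coarse points.

WHAT IS PROVED (0 sorry, 0 `def … : Prop`, 3 data defs `GsymLim`∕`kerReLim`∕`deltaZLim`; all [our object]∕[folklore]):
* §1 SYMBOLS (`Fin d`): `tendsto_Gsym` (`Gsym (j+1) → GsymLim` on the zero-free strip), `GsymLim_sub_Gsym_norm_le` (`≤ 8·C166(d)/n²`), `norm_GsymLim_le` (`≤ MG d`).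
* §2 KERNELS (`ℤ^{d+1}`): **`tendsto_latticeKernel_Gsym`** — DOMINATED CONVERGENCE on the Brillouin zone (integrands bounded by `MG(d+1)`, pointwise
  convergent): `latticeKernel (Gsym (j+1)) x → latticeKernel GsymLim x`; `kerReLim`; `tendsto_kerRe`; `kerReLim_sub_kerRe_abs_le`
  (`|K_∞(x) − K^{(n)}(x)| ≤ 8·C166(d+1)/n²·e^{−(κ₁₆₆/(d+1))|x|₁}`, every `n ≥ 1`); `kerReLim_abs_le`; `kerFamily_sub_kerReLim_abs_le`; `tendsto_kerFamily` (`L ≥ 2`).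
* §3 **Δ_∞**: `deltaZLim`; `deltaZ_sub_deltaZLim` (termwise); **`deltaZ_sub_deltaZLim_abs_le_l1`** ∕ `…_abs_le` (`|Δ_k(b,b′) − Δ_∞(b,b′)| ≤ theta166Z(d)·(L⁻²)^k·
  e^{−kappaZ(d)|x−y|₁}`, every `L ≥ 1`, every `k`); `deltaZLim_abs_le_l1` ∕ `…_abs_le` (`≤ c166Z(d)·e^{−kappaZ(d)|x−y|₁}`); **`tendsto_deltaZ`** (`L ≥ 2`);
  `deltaZLim_symm`; `deltaZLim_pair`; §4 the `Decays`∕`toMKer` currency of `DirichletExhaustionDeltaZConv`: `decays_toMKer_deltaZLim`, `decays_toMKer_deltaZ_sub_deltaZLim`.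
HONEST: names a limit and proves convergence to it with the printed-shape rate; restates nothing of PARTs 8∕9∕19; discharges NOTHING of an2's wall;
NEVER «G-an2-4 closed»; NOT `BetaPertH`, NOT continuum, NOT Clay.

ABSOLUTE RULE (cell, verbatim): «No internally-minted statement may enter as a cited fact. Every hypothesis is either kernel-proved in this package or a
verbatim quotation of a PUBLISHED theorem with page reference. The manuscript(s) under audit are NOT citable for their own disputed steps — they are the
thing under adjudication; programme-internal (2001/route/tribunal) claims are never citable.»  No hypothesis below is a printed statement; nothing is cited
as a fact; every input is a tree theorem imported BY NAME (`tendsto_W166lim`, `W166lim_rate`, `norm_W166lim_le`, `stripRegular_Gsym`, `kerRe_step2`,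
`kerRe_decay`, `deltaZ_symm`, Mathlib's `tendsto_integral_of_dominated_convergence`).
-/

namespace Summit.QuantumFields.BalabanUV.Beta.GAN24.EffectiveLaplacianLimit

open Filter Topology MeasureTheory Finset
open scoped BigOperators
open Literature.MathematicalPhysics.QuantumFieldTheory.Balaban1983to89
open Literature.MathematicalPhysics.QuantumFieldTheory.Balaban1983to89.Beta
open B4Strip (Strip ofRealVec)
open B4ContourShift (BZ integrand fourierBox latticeKernel ofRealVec_mem_Strip norm_cexp_phase)
open B5Symbol166 (W166)
open B5Symbol166Strip (Gsym expFacNeg expFacPos MG MG_pos MW MW_pos kappa166 kappa166_pos norm_expFac_le stripRegular_Gsym)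
open T4Rate166StripDirect (W166lim tendsto_W166lim W166lim_rate norm_W166lim_le C166 C166_pos kerRe_step2 kappa166_le_one
  thetaSq_lt_one)
open T4GaugeActionRateStrip (exp_add_one_le_four)
open T4GaugeActionRatePair (kerRe kerFamily kerRe_decay)
open B12Sec2to5 (l1 l1_nonneg)
open B4Sect5Exhaustion (K)
open ExpKernelCalculus (MKer Decays)
open Summit.QuantumFields.BalabanUV.Beta.GAN24.DirichletExhaustionDeltaZ (deltaZ summand dirI c166Z theta166Z kappaZ kappaZ_pos
  abs_summand_le abs_sum_sum_le exp_l1_le_exp_dist)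
open Summit.QuantumFields.BalabanUV.Beta.GAN24.DirichletExhaustionDeltaZSymm (deltaZ_symm)
open Summit.QuantumFields.BalabanUV.Beta.GAN24.DirichletExhaustionDecays (toMKer)

noncomputable section

/-! ## §1 The continuum entry symbol `GsymLim` -/

section Symbol

variable {d : ℕ}

/-- [our object] **THE CONTINUUM (1.66) ENTRY SYMBOL** between unit forms at bonds of directions `a`, `b`:
`G^{ab}_{μν,∞}(p) = ½ · W_{μν,∞}(p) · (e^{−ip_a} − 1)(e^{ip_b} − 1)`, with `W_{μν,∞} = T4Rate166StripDirect.W166lim` the constructed limit of the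
block-spin multipliers `W^{(n)}_{μν}` (definite on the zero-free strip, junk elsewhere). -/
def GsymLim (μ ν a b : Fin d) (p : Fin d → ℂ) : ℂ :=
  1 / 2 * W166lim μ ν p * (expFacNeg a p * expFacPos b p)

/-- [our object] `Gsym (j+1) → GsymLim` pointwise on the zero-free strip `Strip d κ`, `0 ≤ κ ≤ κ₁₆₆(d)`. -/
theorem tendsto_Gsym {κ : ℝ} (hκ0 : 0 ≤ κ) (hκ : κ ≤ kappa166 d) {p : Fin d → ℂ} (hp : p ∈ Strip d κ) (μ ν a b : Fin d) :
    Tendsto (fun j : ℕ => Gsym (j + 1) μ ν a b p) atTop (𝓝 (GsymLim μ ν a b p)) := by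
  unfold Gsym GsymLim
  exact ((tendsto_W166lim hκ0 hκ hp μ ν).const_mul (1 / 2)).mul_const _

/-- [our object] THE RATE, King's exponent: `‖G_∞(p) − G^{(n)}(p)‖ ≤ 8·C166(d)/n²` on the strip, every `n ≥ 1`. -/
theorem GsymLim_sub_Gsym_norm_le {κ : ℝ} (hκ0 : 0 ≤ κ) (hκ : κ ≤ kappa166 d) {p : Fin d → ℂ} (hp : p ∈ Strip d κ)
    (μ ν a b : Fin d) (n : ℕ) [NeZero n] : ‖GsymLim μ ν a b p - Gsym n μ ν a b p‖ ≤ 8 * C166 d / (n : ℝ) ^ 2 := by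
  have hW := W166lim_rate hκ0 hκ hp μ ν n
  have he := exp_add_one_le_four (hκ.trans (kappa166_le_one d))
  have hN := ((norm_expFac_le hp a).1).trans he
  have hP := ((norm_expFac_le hp b).2).trans he
  have hC := (C166_pos d).le
  unfold Gsym GsymLim
  rw [show 1 / 2 * W166lim μ ν p * (expFacNeg a p * expFacPos b p)
      - 1 / 2 * W166 n μ ν p * (expFacNeg a p * expFacPos b p)
      = 1 / 2 * ((W166lim μ ν p - W166 n μ ν p) * (expFacNeg a p * expFacPos b p)) by ring,
    norm_mul, norm_mul, norm_mul]
  have h12 : ‖(1 / 2 : ℂ)‖ = 1 / 2 := by norm_num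
  rw [h12]
  calc 1 / 2 * (‖W166lim μ ν p - W166 n μ ν p‖ * (‖expFacNeg a p‖ * ‖expFacPos b p‖))
      ≤ 1 / 2 * (C166 d / (n : ℝ) ^ 2 * (4 * 4)) := by gcongr
    _ = 8 * C166 d / (n : ℝ) ^ 2 := by ring

/-- [our object] The continuum entry symbol is bounded by `MG d` on the strip (same constant as every `Gsym n`). -/
theorem norm_GsymLim_le {κ : ℝ} (hκ0 : 0 ≤ κ) (hκ : κ ≤ kappa166 d) {p : Fin d → ℂ} (hp : p ∈ Strip d κ)
    (μ ν a b : Fin d) : ‖GsymLim μ ν a b p‖ ≤ MG d := by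
  have hW := norm_W166lim_le hκ0 hκ hp μ ν
  have he := exp_add_one_le_four (hκ.trans (kappa166_le_one d))
  have hN := ((norm_expFac_le hp a).1).trans he
  have hP := ((norm_expFac_le hp b).2).trans he
  have hMW := (MW_pos d).le
  unfold GsymLim MG
  rw [norm_mul, norm_mul, norm_mul]
  have h12 : ‖(1 / 2 : ℂ)‖ = 1 / 2 := by norm_num
  rw [h12]
  calc 1 / 2 * ‖W166lim μ ν p‖ * (‖expFacNeg a p‖ * ‖expFacPos b p‖)
      ≤ 1 / 2 * MW d * (4 * 4) := by gcongr
    _ = 1 / 2 * MW d * 16 := by ring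

end Symbol

/-! ## §2 Position space on `ℤ^{d+1}`: dominated convergence on the Brillouin zone -/

section Kernel

variable {d : ℕ}

/-- [folklore] The Brillouin zone has finite Lebesgue measure. -/
theorem volume_BZ_ne_top (d : ℕ) : volume (BZ (d + 1)) ≠ ⊤ := by
  unfold BZ
  exact (isCompact_Icc.measure_lt_top).ne

/-- [folklore] The Brillouin zone is measurable. -/
theorem measurableSet_BZ (d : ℕ) : MeasurableSet (BZ (d + 1)) := by
  unfold BZ
  exact measurableSet_Icc

/-- [our object] **THE LATTICE KERNELS CONVERGE TO THE LATTICE KERNEL OF THE LIMIT SYMBOL** (dominated convergence on `[-π,π]^{d+1}`: the integrands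
`Gsym (j+1)(p) e^{ip·x}` are bounded by `MG(d+1)` uniformly in `j` — `stripRegular_Gsym` at width `0` — and converge pointwise — §1 at real momenta). -/
theorem tendsto_latticeKernel_Gsym {μ ν : Fin (d + 1)} (hμν : μ ≠ ν) (a b : Fin (d + 1)) (x : Fin (d + 1) → ℤ) :
    Tendsto (fun j : ℕ => latticeKernel (fun p => Gsym (j + 1) μ ν a b p) x) atTop
      (𝓝 (latticeKernel (GsymLim μ ν a b) x)) := by
  unfold latticeKernel fourierBox
  refine Tendsto.const_smul ?_ _
  have hκ : (0 : ℝ) ≤ kappa166 (d + 1) := (kappa166_pos _).le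
  refine tendsto_integral_of_dominated_convergence (fun _ => MG (d + 1)) ?_ ?_ ?_ ?_
  · intro j
    exact ((stripRegular_Gsym (d := d) (j + 1) hκ le_rfl hμν a b).integrableOn hκ x).aestronglyMeasurable
  · exact integrableOn_const (volume_BZ_ne_top d)
  · intro j
    refine ae_restrict_of_forall_mem (measurableSet_BZ d) fun p hp => ?_
    have hb := (stripRegular_Gsym (d := d) (j + 1) hκ le_rfl hμν a b).bound _ (ofRealVec_mem_Strip hκ hp)
    unfold integrand
    rw [norm_mul, norm_cexp_phase, mul_one]
    exact hb
  · refine ae_restrict_of_forall_mem (measurableSet_BZ d) fun p hp => ?_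
    unfold integrand
    exact (tendsto_Gsym hκ le_rfl (ofRealVec_mem_Strip hκ hp) μ ν a b).mul_const _

/-- [our object] **THE PERFECT (1.66) ENTRY KERNEL** `K^{ab}_{μν,∞}(x) := Re (2π)^{−(d+1)}∫_{[-π,π]^{d+1}} G^{ab}_{μν,∞}(p) e^{ip·x} dp` on `ℤ^{d+1}` — the
`n = ∞` member of `T4GaugeActionRatePair.kerRe n`. -/
def kerReLim (μ ν a b : Fin (d + 1)) (x : Fin (d + 1) → ℤ) : ℝ :=
  (latticeKernel (GsymLim μ ν a b) x).re

/-- [our object] `kerRe (j+1) x → kerReLim x` (`μ ≠ ν`). -/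
theorem tendsto_kerRe {μ ν : Fin (d + 1)} (hμν : μ ≠ ν) (a b : Fin (d + 1)) (x : Fin (d + 1) → ℤ) :
    Tendsto (fun j : ℕ => kerRe (j + 1) μ ν a b x) atTop (𝓝 (kerReLim μ ν a b x)) := by
  unfold kerRe kerReLim
  exact (Complex.continuous_re.tendsto _).comp (tendsto_latticeKernel_Gsym hμν a b x)

/-- [our object] **KING'S (4.31) IN POSITION SPACE WITH THE LIMIT NAMED**: `|K_∞(x) − K^{(n)}(x)| ≤ 8·C166(d+1)/n² · e^{−(κ₁₆₆(d+1)/(d+1))|x|₁}` for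
every `n ≥ 1` (`kerRe_step2` for `n ≤ j+1`, passed to the limit `j → ∞`). -/
theorem kerReLim_sub_kerRe_abs_le {μ ν : Fin (d + 1)} (hμν : μ ≠ ν) (a b : Fin (d + 1)) (x : Fin (d + 1) → ℤ) (n : ℕ) [NeZero n] :
    |kerReLim μ ν a b x - kerRe n μ ν a b x|
      ≤ 8 * C166 (d + 1) / (n : ℝ) ^ 2 * Real.exp (-(kappa166 (d + 1) / ((d : ℝ) + 1)) * l1 x) := by
  have ht := ((tendsto_kerRe hμν a b x).sub_const (kerRe n μ ν a b x)).abs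
  refine le_of_tendsto ht ?_
  rw [eventually_atTop]
  exact ⟨n, fun j hj => kerRe_step2 (n := n) (m := j + 1) (by omega) hμν a b x⟩

/-- [our object] The perfect entry kernel inherits the `n`-uniform decay: `|K_∞(x)| ≤ MG(d+1)·e^{−(κ₁₆₆(d+1)/(d+1))|x|₁}`. -/
theorem kerReLim_abs_le {μ ν : Fin (d + 1)} (hμν : μ ≠ ν) (a b : Fin (d + 1)) (x : Fin (d + 1) → ℤ) :
    |kerReLim μ ν a b x| ≤ MG (d + 1) * Real.exp (-(kappa166 (d + 1) / ((d : ℝ) + 1)) * l1 x) :=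
  le_of_tendsto (tendsto_kerRe hμν a b x).abs (Eventually.of_forall fun j => kerRe_decay (d := d) (j + 1) hμν a b x)

/-- [our object] Along the scale ladder `n = L^k` (every `L ≥ 1`): `|X_k(x) − K_∞(x)| ≤ 8·C166(d+1)·(L⁻²)^k·e^{−(κ₁₆₆(d+1)/(d+1))|x|₁}`. -/
theorem kerFamily_sub_kerReLim_abs_le (L : ℕ) [NeZero L] {μ ν : Fin (d + 1)} (hμν : μ ≠ ν) (a b : Fin (d + 1)) (k : ℕ)
    (x : Fin (d + 1) → ℤ) :
    |kerFamily L μ ν a b k x - kerReLim μ ν a b x|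
      ≤ 8 * C166 (d + 1) * (((L : ℝ) ^ 2)⁻¹) ^ k * Real.exp (-(kappa166 (d + 1) / ((d : ℝ) + 1)) * l1 x) := by
  have h := kerReLim_sub_kerRe_abs_le (n := L ^ k) hμν a b x
  have e : 8 * C166 (d + 1) / (((L ^ k : ℕ) : ℝ)) ^ 2 = 8 * C166 (d + 1) * (((L : ℝ) ^ 2)⁻¹) ^ k := by
    rw [Nat.cast_pow, inv_pow, ← pow_mul, ← pow_mul, mul_comm k 2, div_eq_mul_inv]
  rw [e] at h
  rw [abs_sub_comm]
  exact h

/-- [our object] `X_k(x) = K^{(L^k)}(x) → K_∞(x)` for every blocking factor `L ≥ 2` — the limit does not depend on `L`. -/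
theorem tendsto_kerFamily {L : ℕ} [NeZero L] (hL : 2 ≤ L) {μ ν : Fin (d + 1)} (hμν : μ ≠ ν) (a b : Fin (d + 1))
    (x : Fin (d + 1) → ℤ) : Tendsto (fun k => kerFamily L μ ν a b k x) atTop (𝓝 (kerReLim μ ν a b x)) :=
  LimitRate.tendsto_of_abs_sub_le_geometric
    (c₀ := 8 * C166 (d + 1) * Real.exp (-(kappa166 (d + 1) / ((d : ℝ) + 1)) * l1 x))
    (by positivity) (thetaSq_lt_one hL) fun k => by
      have h := kerFamily_sub_kerReLim_abs_le L hμν a b k x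
      calc |kerFamily L μ ν a b k x - kerReLim μ ν a b x|
          ≤ 8 * C166 (d + 1) * (((L : ℝ) ^ 2)⁻¹) ^ k * Real.exp (-(kappa166 (d + 1) / ((d : ℝ) + 1)) * l1 x) := h
        _ = 8 * C166 (d + 1) * Real.exp (-(kappa166 (d + 1) / ((d : ℝ) + 1)) * l1 x) * (((L : ℝ) ^ 2)⁻¹) ^ k := by
          ring

end Kernel

/-! ## §3 Bałaban's perfect effective Laplacian `Δ_∞` on the bonds of `ℤ^{d+1}` -/

section DeltaLim

variable {d : ℕ}

/-- [our object] **THE PERFECT EFFECTIVE LAPLACIAN `Δ_∞`** on the bond index set `ℤ^{d+1} × Fin (d+1)`: the SAME bond-basis combination as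
`DirichletExhaustionDeltaZ.deltaZ` ((1.66) of [Balaban1984PropagatorsI] p. 29, typed on `ℤ^{d+1}`), built from the perfect entry kernels `kerReLim`
in place of `K^{(L^k)}`.  Depends on neither `L` nor `k`. -/
def deltaZLim (p q : K (d + 1) (d + 1)) : ℝ :=
  ∑ μ : Fin (d + 1), ∑ ν : Fin (d + 1),
    if μ = ν then 0 else summand (fun a b => kerReLim (d := d) μ ν a b) μ ν p.2 q.2 (p.1 - q.1)

/-- [folklore] `Δ_∞` depends on the bond sites only through their difference. -/
theorem deltaZLim_pair (u u' : Fin (d + 1) → ℤ) (κ l : Fin (d + 1)) :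
    deltaZLim (d := d) (u, κ) (u', l) = deltaZLim (u - u', κ) (0, l) := by
  simp only [deltaZLim, sub_zero]

/-- [folklore] The difference `Δ_k − Δ_∞` is the same combination of the differences of the entry kernels. -/
theorem deltaZ_sub_deltaZLim (L : ℕ) [NeZero L] (k : ℕ) (p q : K (d + 1) (d + 1)) :
    deltaZ L k p q - deltaZLim p q =
      ∑ μ : Fin (d + 1), ∑ ν : Fin (d + 1),
        if μ = ν then 0 else
          summand (fun a b z => kerFamily (d := d) L μ ν a b k z - kerReLim μ ν a b z) μ ν p.2 q.2 (p.1 - q.1) := by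
  unfold deltaZ deltaZLim
  rw [← Finset.sum_sub_distrib]
  refine Finset.sum_congr rfl fun μ _ => ?_
  rw [← Finset.sum_sub_distrib]
  refine Finset.sum_congr rfl fun ν _ => ?_
  split_ifs with h
  · simp
  · simp only [summand]; ring

/-- [our object] **`Δ_k → Δ_∞` AT KING'S RATE, `ℓ¹` FORM**: `|Δ_k(b,b′) − Δ_∞(b,b′)| ≤ theta166Z(d)·(L⁻²)^k·e^{−kappaZ(d)·|x−y|₁}` for every `L ≥ 1`,
every `k`, all bonds `b = (x,α)`, `b′ = (y,β)` — the constant and rate of PART 8's one-step bound `deltaZ_step_abs_le`, now against the LIMIT. -/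
theorem deltaZ_sub_deltaZLim_abs_le_l1 (L : ℕ) [NeZero L] (k : ℕ) (p q : K (d + 1) (d + 1)) :
    |deltaZ L k p q - deltaZLim p q| ≤
      theta166Z d * (((L : ℝ) ^ 2)⁻¹) ^ k * Real.exp (-(kappaZ d) * l1 (p.1 - q.1)) := by
  have hE : ∀ μ ν, μ ≠ ν → ∀ a b, |kerFamily (d := d) L μ ν a b k (p.1 - q.1) - kerReLim μ ν a b (p.1 - q.1)| ≤
      8 * C166 (d + 1) * (((L : ℝ) ^ 2)⁻¹) ^ k * Real.exp (-(kappaZ d) * l1 (p.1 - q.1)) := by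
    intro μ ν hμν a b
    have h := kerFamily_sub_kerReLim_abs_le (d := d) L hμν a b k (p.1 - q.1)
    unfold kappaZ
    exact h
  have hB : 0 ≤ 4 * (8 * C166 (d + 1) * (((L : ℝ) ^ 2)⁻¹) ^ k * Real.exp (-(kappaZ d) * l1 (p.1 - q.1))) := by
    have := C166_pos (d + 1); positivity
  rw [deltaZ_sub_deltaZLim]
  refine (abs_sum_sum_le hB fun μ ν hμν => abs_summand_le (hE μ ν hμν) μ ν p.2 q.2).trans (le_of_eq ?_)
  unfold theta166Z; ring

/-- [our object] The same in PART 8's sup-distance form: `|Δ_k(b,b′) − Δ_∞(b,b′)| ≤ theta166Z(d)·(L⁻²)^k·e^{−kappaZ(d)·|x−y|_∞}`. -/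
theorem deltaZ_sub_deltaZLim_abs_le (L : ℕ) [NeZero L] (k : ℕ) (p q : K (d + 1) (d + 1)) :
    |deltaZ L k p q - deltaZLim p q| ≤
      theta166Z d * (((L : ℝ) ^ 2)⁻¹) ^ k * Real.exp (-(kappaZ d * dist p.1 q.1)) := by
  refine (deltaZ_sub_deltaZLim_abs_le_l1 L k p q).trans (mul_le_mul_of_nonneg_left ?_ ?_)
  · have h := exp_l1_le_exp_dist (kappaZ_pos d).le p.1 q.1
    simpa [neg_mul] using h
  · have := C166_pos (d + 1); unfold theta166Z; positivity

/-- [our object] **DECAY OF `Δ_∞`, `ℓ¹` FORM**: `|Δ_∞(b,b′)| ≤ c166Z(d)·e^{−kappaZ(d)·|x−y|₁}` (PART 8's `k`-uniform constant, inherited). -/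
theorem deltaZLim_abs_le_l1 (p q : K (d + 1) (d + 1)) :
    |deltaZLim (d := d) p q| ≤ c166Z d * Real.exp (-(kappaZ d) * l1 (p.1 - q.1)) := by
  have hE : ∀ μ ν, μ ≠ ν → ∀ a b, |kerReLim (d := d) μ ν a b (p.1 - q.1)| ≤
      MG (d + 1) * Real.exp (-(kappaZ d) * l1 (p.1 - q.1)) := by
    intro μ ν hμν a b
    have h := kerReLim_abs_le (d := d) hμν a b (p.1 - q.1)
    unfold kappaZ
    exact h
  have hB : 0 ≤ 4 * (MG (d + 1) * Real.exp (-(kappaZ d) * l1 (p.1 - q.1))) := by have := MG_pos (d + 1); positivity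
  unfold deltaZLim
  refine (abs_sum_sum_le hB fun μ ν hμν => abs_summand_le (hE μ ν hμν) μ ν p.2 q.2).trans (le_of_eq ?_)
  unfold c166Z; ring

/-- [our object] Decay of `Δ_∞` in PART 8's sup-distance form. -/
theorem deltaZLim_abs_le (p q : K (d + 1) (d + 1)) :
    |deltaZLim (d := d) p q| ≤ c166Z d * Real.exp (-(kappaZ d * dist p.1 q.1)) := by
  refine (deltaZLim_abs_le_l1 p q).trans (mul_le_mul_of_nonneg_left ?_ ?_)
  · have h := exp_l1_le_exp_dist (kappaZ_pos d).le p.1 q.1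
    simpa [neg_mul] using h
  · have := MG_pos (d + 1); unfold c166Z; positivity

/-- [our object] **`Δ_k → Δ_∞` ENTRYWISE FOR EVERY BLOCKING FACTOR `L ≥ 2`** — one perfect Laplacian for all `L`. -/
theorem tendsto_deltaZ {L : ℕ} [NeZero L] (hL : 2 ≤ L) (p q : K (d + 1) (d + 1)) :
    Tendsto (fun k => deltaZ L k p q) atTop (𝓝 (deltaZLim p q)) :=
  LimitRate.tendsto_of_abs_sub_le_geometric
    (c₀ := theta166Z d * Real.exp (-(kappaZ d) * l1 (p.1 - q.1)))
    (by positivity) (thetaSq_lt_one hL) fun k => by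
      have h := deltaZ_sub_deltaZLim_abs_le_l1 (d := d) L k p q
      calc |deltaZ L k p q - deltaZLim p q|
          ≤ theta166Z d * (((L : ℝ) ^ 2)⁻¹) ^ k * Real.exp (-(kappaZ d) * l1 (p.1 - q.1)) := h
        _ = theta166Z d * Real.exp (-(kappaZ d) * l1 (p.1 - q.1)) * (((L : ℝ) ^ 2)⁻¹) ^ k := by ring

/-- [our object] `Δ_∞` IS SYMMETRIC (PART 9's `deltaZ_symm` passed to the limit along `L = 2`). -/
theorem deltaZLim_symm (p q : K (d + 1) (d + 1)) : deltaZLim (d := d) p q = deltaZLim q p := by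
  haveI : NeZero (2 : ℕ) := ⟨by norm_num⟩
  have h₁ := tendsto_deltaZ (d := d) (L := 2) le_rfl p q
  have h₂ := tendsto_deltaZ (d := d) (L := 2) le_rfl q p
  have h₁' : Tendsto (fun k => deltaZ (d := d) 2 k q p) atTop (𝓝 (deltaZLim p q)) := by
    refine h₁.congr fun k => ?_
    exact deltaZ_symm 2 k p q
  exact tendsto_nhds_unique h₁' h₂

end DeltaLim

/-! ## §4 The `Decays` ∕ `toMKer` currency of `DirichletExhaustionDeltaZConv` and of the X1m-mm consumer -/

section Currency

variable {d : ℕ}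

/-- [our object] `Decays (toMKer Δ_∞) (c166Z d) (kappaZ d)` — the limit in the matrix-kernel currency of an2's `ExpKernelCalculus`. -/
theorem decays_toMKer_deltaZLim : Decays (toMKer (deltaZLim (d := d))) (c166Z d) (kappaZ d) := by
  intro x y a b
  have h := deltaZLim_abs_le_l1 (d := d) (x, a) (y, b)
  simpa [toMKer, neg_mul] using h

/-- [our object] **THE RATE TO THE NAMED LIMIT IN `Decays` CURRENCY**: `Decays (toMKer Δ_k − toMKer Δ_∞) (theta166Z(d)·(L⁻²)^k) (kappaZ d)` for every
`L ≥ 1`, every `k` — the hypothesis shape `h` of `HessKerDressedLimit.tendsto_of_decays_rate` ∕ `limMKerOf_eq_of_decays_rate`. -/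
theorem decays_toMKer_deltaZ_sub_deltaZLim (L : ℕ) [NeZero L] (k : ℕ) :
    Decays (toMKer (deltaZ (d := d) L k) - toMKer (deltaZLim (d := d))) (theta166Z d * (((L : ℝ) ^ 2)⁻¹) ^ k) (kappaZ d) := by
  intro x y a b
  have h := deltaZ_sub_deltaZLim_abs_le_l1 (d := d) L k (x, a) (y, b)
  simpa [toMKer, ExpKernelCalculus.MKer, neg_mul] using h

end Currency

end

end Summit.QuantumFields.BalabanUV.Beta.GAN24.EffectiveLaplacianLimit
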